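import Summits.KontsevichZagierPeriods.KontsevichZagierPeriods.Theses.FurushoPentagon
import Literature.NumberTheory.Transcendental.DrinfeldAssociatorRegularisation
import Literature.NumberTheory.Transcendental.ShuffleAlgebra

/-!
# `PentagonInKZ`, line `logfree-gauge-corner-flatness`: the log-free transports are group-like

Stub `stub_groupLike` of the crux `FurushoPentagon.PentagonInKZ`
(stmt-KontsevichZagierPeriods-11348).
Pure algebra.  For a realisation `χ` of the Kontsevich–Zagier rules and the path families `I p`,
the classes `χ₀(w) := χ[I p w]` of the words `w` NOT ending in the letter `0` satisfy the shuffle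
relation `χ₀(u) χ₀(v) = Σ_{w ∈ u ш v} χ₀(w)` (hypothesis: the class-level shuffle product, and `χ`
is multiplicative and kills `KZ.relations`).  The log-free transport series
`P p W = ⟨χ₀, regEnd₀ W⟩` (`W ≠ []`, `P p [] = 1`) is then GROUP-LIKE, because IKZ's end
regularisation `regEnd₀ = Σ_k (-1)^k 0^k ш (· minus its last k letters)` (`Shuffle.regEnd`) is

* a homomorphism for the shuffle product (`GroupLike.sum_map_regEnd_shuffleWord`:
  `Σ_{w ∈ u ш v} regEnd w = regEnd u ш regEnd v`, bilinearly), being coefficientwise the Taylor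
  (constant-term) map of the derivation `∂₀` of the completed shuffle algebra
  (`GroupLike.regEnd_apply_eq_endTaylor`, `ShuffleAlgebra.TaylorSystem.taylor_mul`) — the mirror
  image of [IharaKanekoZagier2006, §2 Prop. 1, §3 Cor. 5], over a general alphabet;
* supported on words not ending in `0` (`Shuffle.getLast?_ne_of_mem_support_regEnd`).

Hence `⟨χ₀, regEnd u⟩ ⟨χ₀, regEnd v⟩ = Σ_{w ∈ u ш v} ⟨χ₀, regEnd w⟩` for ALL words `u, v`
(`GroupLike.pair_regEnd_mul`), which is the shuffle relation of `P p` (the empty word only occurs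
through `[] ш v = v`).

References: K. Ihara, M. Kaneko, D. Zagier, Compos. Math. 142 (2006), §2 Prop. 1, §3, Cor. 5;
C. Reutenauer, *Free Lie algebras* (1993), §1.4–1.5, §6.
-/

noncomputable section

open scoped BigOperators
open Literature.NumberTheory.Transcendental

namespace Summit.KontsevichZagierPeriods.FurushoPentagon.PentagonInKZ

namespace GroupLike

open ShuffleAlgebra

variable {α : Type*} [DecidableEq α]

/-! ## 1. `Shuffle.regEnd` is the end Taylor map of the completed shuffle algebra -/

omit [DecidableEq α] in
/-- `Shuffle.wordSum L` is `Σ_{w ∈ L} w` in the completed shuffle algebra, coefficientwise.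
[folklore] -/
theorem wordSum_apply_eq (L : List (List α)) (v : List α) [DecidableEq α] :
    Shuffle.wordSum L v = ((L.map word).sum : ShuffleAlgebra α ℚ) v := by
  induction L with
  | nil => simp
  | cons w L ih =>
    rw [Shuffle.wordSum_cons, Finsupp.add_apply, ih, List.map_cons, List.sum_cons,
      ShuffleAlgebra.add_apply, Finsupp.single_apply, word_apply]
    by_cases h : v = w
    · subst h; simp
    · rw [if_neg h, if_neg (Ne.symm h)]

/-- `Shuffle.shuffleSum u u'` is the shuffle product `u ш u'` of the completed shuffle algebra,
coefficientwise. [cite: Reutenauer1993, §1.4] -/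
theorem shuffleSum_apply_eq (u u' v : List α) :
    Shuffle.shuffleSum u u' v = (word u * word u' : ShuffleAlgebra α ℚ) v := by
  rw [Shuffle.shuffleSum, wordSum_apply_eq, word_mul_word]

/-- Structure of a word along its trailing block of `x`'s: `w = u₀ xⁿ`, `n = leadCount x w̃`,
with `u₀` not ending in `x`. [cite: IharaKanekoZagier2006, Cor. 5 (w = yᵐ w₀, mirror image)] -/
theorem eq_append_replicate_leadCount (x : α) (w : List α) :
    ∃ u₀ : List α, w = u₀ ++ List.replicate (Shuffle.leadCount x w.reverse) x ∧
      u₀.getLast? ≠ some x := by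
  refine ⟨(w.reverse.drop (Shuffle.leadCount x w.reverse)).reverse, ?_, ?_⟩
  · have h := congrArg List.reverse (Shuffle.replicate_leadCount_append_drop x w.reverse)
    rw [List.reverse_append, List.reverse_replicate, List.reverse_reverse] at h
    exact h.symm
  · rw [List.getLast?_reverse]
    exact Shuffle.drop_leadCount_head_ne x w.reverse

/-- The number of trailing `x`'s is at most the length. [folklore] -/
theorem leadCount_reverse_le_length (x : α) (w : List α) :
    Shuffle.leadCount x w.reverse ≤ w.length := by
  obtain ⟨u₀, hw, -⟩ := eq_append_replicate_leadCount x w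
  have h := congrArg List.length hw
  simp only [List.length_append, List.length_replicate] at h
  omega

/-- `∂ₓᵏ w = (w minus its last k letters)` for `k` at most the number of trailing `x`'s.
[cite: IharaKanekoZagier2006, Cor. 5] -/
theorem dEnd_iterate_word_of_le_leadCount (x : α) (w : List α) {k : ℕ}
    (hk : k ≤ Shuffle.leadCount x w.reverse) :
    (dEnd x)^[k] (word w : ShuffleAlgebra α ℚ) = word (w.take (w.length - k)) := by
  obtain ⟨u₀, hw, -⟩ := eq_append_replicate_leadCount x w
  generalize Shuffle.leadCount x w.reverse = n at hw hk
  subst hw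
  obtain ⟨e, rfl⟩ : ∃ e, n = e + k := ⟨n - k, by omega⟩
  rw [List.replicate_add, ← List.append_assoc]
  have hlen : (u₀ ++ List.replicate e x ++ List.replicate k x).length - k =
      (u₀ ++ List.replicate e x).length := by
    simp only [List.length_append, List.length_replicate]; omega
  rw [hlen, List.take_left]
  ext v
  rw [dEnd_iterate_apply, word_apply, word_apply]
  simp only [List.append_cancel_right_eq]

/-- `∂ₓᵏ w = 0` for `k` beyond the number of trailing `x`'s.
[cite: IharaKanekoZagier2006, Cor. 5] -/
theorem dEnd_iterate_word_of_leadCount_lt (x : α) (w : List α) {k : ℕ}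
    (hk : Shuffle.leadCount x w.reverse < k) :
    (dEnd x)^[k] (word w : ShuffleAlgebra α ℚ) = 0 := by
  obtain ⟨u₀, hw, hu₀⟩ := eq_append_replicate_leadCount x w
  generalize Shuffle.leadCount x w.reverse = n at hw hk
  subst hw
  ext v
  rw [dEnd_iterate_apply, word_apply, ShuffleAlgebra.zero_apply, if_neg]
  intro h
  apply hu₀
  obtain ⟨d, rfl⟩ : ∃ d, k = d + 1 + n := ⟨k - n - 1, by omega⟩
  rw [List.replicate_add, ← List.append_assoc, List.append_cancel_right_eq] at h
  rw [← h, List.replicate_succ', ← List.append_assoc]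
  simp

/-- IKZ's end-regularisation formula with the reversals unfolded:
`regEnd x w = Σ_{k ≤ n} (-1)^k xᵏ ш (w minus its last k letters)`, `n` the number of trailing `x`'s.
[cite: IharaKanekoZagier2006, Cor. 5 (mirror image)] -/
theorem regEnd_eq_sum_take (x : α) (w : List α) :
    Shuffle.regEnd x w = ∑ k ∈ Finset.range (Shuffle.leadCount x w.reverse + 1),
      ((-1 : ℚ) ^ k) • Shuffle.shuffleSum (List.replicate k x) (w.take (w.length - k)) := by
  unfold Shuffle.regEnd Shuffle.regFront
  rw [Finsupp.mapDomain_finsetSum]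
  refine Finset.sum_congr rfl fun k _ => ?_
  rw [Finsupp.mapDomain_smul, ← Shuffle.shuffleSum_reverse, List.reverse_replicate,
    List.drop_reverse, List.reverse_reverse]

/-- **`Shuffle.regEnd x w` is the end Taylor map `τ^{end}_{|w|+1}(w)` of the derivation `∂ₓ`**,
coefficientwise (general alphabet; the `Bool` case is `ShuffleAlgebra.regEnd_apply`).
[cite: IharaKanekoZagier2006, Cor. 5] -/
theorem regEnd_apply_eq_endTaylor (x : α) (w v : List α) :
    Shuffle.regEnd x w v = (endSystem x).taylor (w.length + 1) (word w : ShuffleAlgebra α ℚ) v := by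
  rw [regEnd_eq_sum_take, Finsupp.finsetSum_apply, TaylorSystem.taylor, finset_sum_apply]
  symm
  have hsub : Finset.range (Shuffle.leadCount x w.reverse + 1) ⊆ Finset.range (w.length + 1) :=
    Finset.range_mono (Nat.succ_le_succ (leadCount_reverse_le_length x w))
  refine ((Finset.sum_subset hsub fun k hk hk' => ?_).symm).trans
    (Finset.sum_congr rfl fun k hk => ?_)
  · rw [Finset.mem_range] at hk hk'
    rw [neg_one_pow_mul_apply, endSystem_t, endSystem_D,
      dEnd_iterate_word_of_leadCount_lt x w (by omega), mul_zero, ShuffleAlgebra.zero_apply,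
      mul_zero]
  · rw [Finset.mem_range, Nat.lt_succ_iff] at hk
    rw [Finsupp.smul_apply, shuffleSum_apply_eq, neg_one_pow_mul_apply, endSystem_t, endSystem_D,
      dEnd_iterate_word_of_le_leadCount x w hk, smul_eq_mul]

/-! ## 2. `regEnd` is a shuffle homomorphism -/

/-- **The end Taylor map is multiplicative on words**:
`Σ_{w ∈ u ш v} τ^{end}(w) = τ^{end}(u) ш τ^{end}(v)`. [cite: IharaKanekoZagier2006, §2 Prop. 1] -/
theorem sum_map_endTaylor_shuffleWord (x : α) (u v : List α) :
    ((MZV.shuffleWord u v).map fun w =>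
        (endSystem x).taylor (w.length + 1) (word w : ShuffleAlgebra α ℚ)).sum =
      (endSystem x).taylor (u.length + 1) (word u) *
        (endSystem x).taylor (v.length + 1) (word v) := by
  rw [← (endSystem x).taylor_mul (dEnd_iterate_word_eq_zero x u) (dEnd_iterate_word_eq_zero x v),
    word_mul_word, TaylorSystem.taylor_list_sum]
  refine congrArg List.sum (List.map_congr_left fun w hw => ?_)
  have hl : w.length = u.length + v.length := MZV.length_of_mem_shuffleWord u v hw
  have hK : w.length + 1 ≤ u.length + 1 + (v.length + 1) := by omega
  rw [(endSystem x).taylor_eq_of_le (dEnd_iterate_word_eq_zero x w) hK]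

/-- `τ^{end}(w)` expanded on the (finite) support of `Shuffle.regEnd x w`. [folklore] -/
theorem endTaylor_eq_sum_support (x : α) (w : List α) :
    (endSystem x).taylor (w.length + 1) (word w : ShuffleAlgebra α ℚ) =
      ∑ u ∈ (Shuffle.regEnd x w).support, C (Shuffle.regEnd x w u) * word u := by
  ext v
  rw [finset_sum_apply]
  simp only [C_mul_apply, word_apply, mul_ite, mul_one, mul_zero]
  rw [Finset.sum_ite_eq]
  split_ifs with h
  · exact (regEnd_apply_eq_endTaylor x w v).symm
  · rw [Finsupp.mem_support_iff, not_not] at h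
    rw [← regEnd_apply_eq_endTaylor, h]

omit [DecidableEq α] in
/-- A list sum of elements of `ℚ⟨α⟩`, coefficientwise. [folklore] -/
theorem finsupp_list_sum_apply (L : List (List α →₀ ℚ)) (r : List α) :
    L.sum r = (L.map fun f => f r).sum := by
  induction L with
  | nil => rfl
  | cons f L ih => rw [List.sum_cons, List.map_cons, List.sum_cons, Finsupp.add_apply, ih]

/-- **IKZ's end regularisation is a shuffle homomorphism** (general alphabet, bilinear form):
`Σ_{w ∈ u ш v} regEnd x w = Σ_{a, b} (regEnd x u)_a (regEnd x v)_b · a ш b`.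
[cite: IharaKanekoZagier2006, §2 Prop. 1 and §3 Cor. 5 (mirror image)] -/
theorem sum_map_regEnd_shuffleWord (x : α) (u v : List α) :
    ((MZV.shuffleWord u v).map (Shuffle.regEnd x)).sum =
      ∑ a ∈ (Shuffle.regEnd x u).support, ∑ b ∈ (Shuffle.regEnd x v).support,
        (Shuffle.regEnd x u a * Shuffle.regEnd x v b) • Shuffle.shuffleSum a b := by
  ext r
  rw [finsupp_list_sum_apply, List.map_map, Finsupp.finsetSum_apply]
  have h1 : ((MZV.shuffleWord u v).map ((fun f : List α →₀ ℚ => f r) ∘ Shuffle.regEnd x)).sum =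
      ((MZV.shuffleWord u v).map fun w =>
        (endSystem x).taylor (w.length + 1) (word w : ShuffleAlgebra α ℚ)).sum r := by
    rw [list_sum_apply, List.map_map]
    exact congrArg List.sum (List.map_congr_left fun w _ => regEnd_apply_eq_endTaylor x w r)
  rw [h1, sum_map_endTaylor_shuffleWord, endTaylor_eq_sum_support x u,
    endTaylor_eq_sum_support x v, Finset.sum_mul_sum, finset_sum_apply]
  refine Finset.sum_congr rfl fun a _ => ?_
  rw [Finsupp.finsetSum_apply, finset_sum_apply]
  refine Finset.sum_congr rfl fun b _ => ?_
  rw [mul_mul_mul_comm, ← C_mul, C_mul_apply, Finsupp.smul_apply, shuffleSum_apply_eq, smul_eq_mul]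

/-! ## 3. Shuffle characters on `x`-end-free words extend through `regEnd` -/

omit [DecidableEq α] in
/-- The pairing of a list sum. [folklore] -/
theorem pair_list_sum {K : Type*} [AddCommMonoid K] [Module ℚ K] (χ : List α → K)
    (L : List (List α →₀ ℚ)) : Shuffle.pair χ L.sum = (L.map (Shuffle.pair χ)).sum := by
  induction L with
  | nil => simp [Shuffle.pair_zero]
  | cons F L ih => rw [List.sum_cons, Shuffle.pair_add, ih, List.map_cons, List.sum_cons]

/-- **A shuffle character on the words not ending in `x` extends through `regEnd x` to a shuffle
character on all words**: if `χ(a) χ(b) = Σ_{w ∈ a ш b} χ(w)` whenever `a, b` do not end in `x`,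
then `⟨χ, regEnd x u⟩ ⟨χ, regEnd x v⟩ = Σ_{w ∈ u ш v} ⟨χ, regEnd x w⟩` for ALL `u, v`.
[cite: IharaKanekoZagier2006, §2 Prop. 1 (mirror image: 𝔥 = 𝔥'[x] with 𝔥' the x-end-free words)] -/
theorem pair_regEnd_mul {K : Type*} [CommRing K] [Algebra ℚ K] (χ : List α → K) (x : α)
    (hχ : ∀ a b : List α, a.getLast? ≠ some x → b.getLast? ≠ some x →
      χ a * χ b = ((MZV.shuffleWord a b).map χ).sum) (u v : List α) :
    Shuffle.pair χ (Shuffle.regEnd x u) * Shuffle.pair χ (Shuffle.regEnd x v) =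
      ((MZV.shuffleWord u v).map fun w => Shuffle.pair χ (Shuffle.regEnd x w)).sum := by
  have hR : ((MZV.shuffleWord u v).map fun w => Shuffle.pair χ (Shuffle.regEnd x w)).sum =
      Shuffle.pair χ ((MZV.shuffleWord u v).map (Shuffle.regEnd x)).sum := by
    rw [pair_list_sum, List.map_map]; rfl
  rw [hR, sum_map_regEnd_shuffleWord, Shuffle.pair_sum]
  simp only [Shuffle.pair_sum, Shuffle.pair_smul, Shuffle.pair_shuffleSum]
  simp only [Shuffle.pair, Finsupp.sum]
  rw [Finset.sum_mul_sum]
  refine Finset.sum_congr rfl fun a ha => Finset.sum_congr rfl fun b hb => ?_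
  rw [← hχ a b (Shuffle.getLast?_ne_of_mem_support_regEnd x u ha)
    (Shuffle.getLast?_ne_of_mem_support_regEnd x v hb), smul_mul_smul_comm]

end GroupLike

open GroupLike in
/-- **Stub `stub_groupLike`** [M]: the LOG-FREE TRANSPORTS ARE GROUP-LIKE. Given the
class-level shuffle product of `stub_shuffleProduct`, every realisation `χ` of the rules turns the
end-regularised series `P p W = ⟨χ[I p ·], regEnd₀ W⟩` into a group-like series over `R`
(the end regularisation `regEnd₀ = Σ_k (-1)^k 0^k ш (· minus its last k letters)` is a
homomorphism of shuffle algebras onto the words not ending in `0`, IKZ 2006 Prop. 1 / Cor. 5 in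
mirror image, cf. `ShuffleAlgebra.endSystem`, `TaylorSystem.taylor_mul`; and `χ` is multiplicative
and kills `KZ.relations`). [cite: IharaKanekoZagier2006, §2 Prop. 1] -/
theorem stub_groupLike :
    ∀ (R : Type) [CommRing R] [Algebra ℚ R] (χ : KZ.FormalRep →+ R), (∀ c ∈ KZ.relations, χ c = 0) → (∀ x y : KZ.FormalRep, χ (x * y) = χ x * χ y) → (∃ u : KZ.FormalRep, χ u = 1) → ∀ (I : (p : Fin 15) → (w : List (Fin 3)) → KZ.IntegralRep w.length), (∀ (p : Fin 15) (w : List (Fin 3)), w.getLast? ≠ some 0 → (I p w).domain = {t | (∀ i, 0 < t i ∧ t i < (![1/2, 1/2, 1/2, 1/2, 1/2, 1/2, 1/2, 1/2, 1/2, 1/2, 1, 1, 1/2, 1/2, 1/2] : Fin 15 → ℝ) p) ∧ StrictAnti t} ∧ Set.EqOn (I p w).integrand (fun t => ∏ i, 1 / (t i - (![![0, 1, 2], ![0, 1, -1], ![0, 1, 2], ![0, 1, -1], ![0, 1, 2], ![0, 1, 2], ![0, 1, 2], ![0, 1, 2], ![0, 1, 2], ![0, 1, 2], ![0, -1, 2],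 ![0, -1, 2], ![0, 1, 2], ![0, 1, 2], ![0, 1, 2]] : Fin 15 → Fin 3 → ℝ) p (w.get i))) (I p w).domain) → (∀ (p : Fin 15) (u v : List (Fin 3)), u.getLast? ≠ some 0 → v.getLast? ≠ some 0 → KZ.of (I p u) * KZ.of (I p v) - ((MZV.shuffleWord u v).map (fun w => KZ.of (I p w))).sum ∈ KZ.relations) → ∀ (P : Fin 15 → NCSeries (Fin 3) R), (∀ (p : Fin 15) (W : List (Fin 3)), P p W = if W = [] then 1 else Shuffle.pair (fun w => χ (KZ.of (I p w))) (Shuffle.regEnd 0 W)) → (∀ p : Fin 15, NCSeries.IsGroupLike (P p)) := by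
  intro R _ _ χ hrel hmul _ I _ hSh P hP p
  -- `χ₀ = χ[I p ·]` is a shuffle character on the words not ending in `0`
  have hχ : ∀ a b : List (Fin 3), a.getLast? ≠ some 0 → b.getLast? ≠ some 0 →
      (fun w => χ (KZ.of (I p w))) a * (fun w => χ (KZ.of (I p w))) b =
        ((MZV.shuffleWord a b).map fun w => χ (KZ.of (I p w))).sum := by
    intro a b ha hb
    have h := hrel _ (hSh p a b ha hb)
    rw [map_sub, sub_eq_zero, hmul, map_list_sum, List.map_map] at h
    exact h
  refine ⟨by rw [hP p [], if_pos rfl], fun u v => ?_⟩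
  rcases u with _ | ⟨a, u⟩
  · rw [hP p [], if_pos rfl, one_mul, MZV.shuffleWord_nil_left, List.map_cons, List.map_nil,
      List.sum_cons, List.sum_nil, add_zero]
  rcases v with _ | ⟨b, v⟩
  · rw [hP p [], if_pos rfl, mul_one, MZV.shuffleWord_nil_right, List.map_cons, List.map_nil,
      List.sum_cons, List.sum_nil, add_zero]
  rw [hP p (a :: u), hP p (b :: v), if_neg (List.cons_ne_nil _ _), if_neg (List.cons_ne_nil _ _),
    pair_regEnd_mul (fun w => χ (KZ.of (I p w))) (0 : Fin 3) hχ (a :: u) (b :: v)]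
  refine congrArg List.sum (List.map_congr_left fun w hw => ?_)
  have hne : w ≠ [] := by
    intro h
    have hl := MZV.length_of_mem_shuffleWord _ _ hw
    rw [h] at hl
    simp only [List.length_nil, List.length_cons] at hl
    omega
  rw [hP p w, if_neg hne]

end Summit.KontsevichZagierPeriods.FurushoPentagon.PentagonInKZ
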